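import Mathlib.Geometry.Manifold.Instances.Sphere
import Mathlib.Geometry.Manifold.Diffeomorph
import Mathlib.Topology.Homotopy.Equiv
import Mathlib.AlgebraicTopology.FundamentalGroupoid.SimplyConnected
import Literature.Topology.FourManifolds.Trisections
import Literature.Topology.FourManifolds.TrisectionEuler
import Literature.Topology.FourManifolds.HomotopyS4OrientableProofs
import Literature.Topology.FourManifolds.HomotopyS4CompactProofs
import HarnessLib

/-!
# Barrier (SmoothPoincare4): trisections of genus `≤ 2` (and `kᵢ ≥ g - 1`) carry no exotic 4-sphere (Meier–Zupan, Meier–Schirmer–Zupan)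

Barrier catalogue `Literature/Barriers/SmoothPoincare4/` (D-0021), entry for the technique class
**"exhibit an exotic 4-sphere by a low-genus trisection (diagram)"** — every closed connected
oriented smooth 4-manifold has a Gay–Kirby trisection, and one could hope to write down an exotic
homotopy 4-sphere as a `(g; k₁, k₂, k₃)`-trisection diagram of small genus. For genus `g ≤ 2`,
and for any `g` with some `kᵢ ≥ g - 1`, the trisected manifolds are classified and contain no
exotic sphere; the first undecided type is `(3; 1, 1, 1)`.

## What is printed

* Meier–Zupan 2017 (Geom. Topol. 21; arXiv:1410.8133), Thm. 1.3 of the arXiv version (journal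
  Thm. 1.2): "If `X` admits a genus two trisection, then `X` is either `S² × S²` or a connected
  sum of `S¹ × S³`, `ℂP²`, and `ℂP²bar` with two summands. Moreover, each of these 4-manifolds has
  a unique genus two trisection up to diffeomorphism."; §1: a `(g, g)`-trisected `X` "is
  diffeomorphic to `#ᵍ(S¹ × S³)` (where `#⁰(S¹ × S³) = S⁴`)" (Laudenbach–Poénaru), and genus-one
  trisections give `ℂP²`, `ℂP²bar`, `S¹ × S³` [Gay–Kirby].
* Meier–Schirmer–Zupan 2016 (Proc. AMS 144; arXiv:1507.06561), Thm. 1.2 of the arXiv version: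
  "Suppose that `X` admits a `(g; k₁, k₂, k₃)`-trisection `T` with `k₁ ≥ g - 1`, and let
  `k = max{k₂, k₃}`. Then, `X` is diffeomorphic either to `#ᵏ(S¹ × S³)` or to the connected sum of
  `#ᵏ S¹ × S³` with one of `ℂP²` or `ℂP²bar`, and `T` is the connected sum of genus one
  trisections."; §3: "Even the case of `S⁴` (equipped with its standard smooth structure) is not
  well-understood ... Conjecture 3.11. Every trisection `T` of `S⁴` is isotopic to `S₀` or one of
  its stabilizations" ("Despite the fact that it is likely false (see Section 6)").
* Gay–Kirby 2016, Thm. 4 (tree fact `Literature.Topology.FourManifolds.exists_isBalancedGKTrisection`): every closed connected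
  oriented smooth 4-manifold admits a balanced `(g, k)`-trisection.

## How it is rendered here (relative to the tree's notions, D-0014)

Trisections are the tree's CORRECTED predicate `Literature.IsGKTrisection X g k S` (`Trisections.lean`:
sectors with corners along the central surface; the older `Literature.Topology.FourManifolds.IsTrisection` is unsatisfiable,
`TrisectionsRefutation.lean`, so the homotopy-sphere corollaries of `SmallTrisections.lean`,
stated over it, are vacuous and are re-vendored here over `IsGKTrisection`).

* `ExoticTrisectedSphereOfGenusLE g₀` — the technique class, explicit and graded: a closed
  connected oriented smooth 4-manifold `X ≃ₕ S⁴`, with an `IsGKTrisection` of genus `g ≤ g₀`, not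
  diffeomorphic to `S⁴`; monotone in `g₀`; PROVED: every exotic 4-sphere lies in SOME class
  (`exoticTrisectedSphereOfGenusLE_of_exotic`, from Gay–Kirby existence as hypothesis and the
  tree's proved orientability of homotopy 4-spheres).
* `mz_genus_le_two_homotopySphere_gk`, `msz_homotopySphere_gk` — named facts (the homotopy-sphere
  corollaries of the two classifications, conclusion "`≅ S⁴`", over `IsGKTrisection`).
* `LowGenusTrisectionBarrier := ¬ ExoticTrisectedSphereOfGenusLE 2` and `LargeKTrisectionBarrier`
  — PROVED from the facts.
* `lowGenusTrisectionBarrier_of_msz` — PROVED: the genus-`≤ 2` barrier already follows from the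
  MSZ fact together with the Euler-characteristic fact
  `Literature.Topology.FourManifolds.gkTrisection_genus_eq_sum_of_homotopyEquiv_sphere`
  (GK Remark 2 / MSZ Remark 3.12: a trisected homotopy 4-sphere has `g = k₀ + k₁ + k₂`), with NO
  input from Meier–Zupan's classification of `(2; 0,0,0)`-trisections: for `g ≤ 2` the constraint
  leaves only the types `(0;0,0,0)`, `(1;1,0,0)`, `(2;2,0,0)`, `(2;1,1,0)` up to relabelling, all
  with some `kᵢ ≥ g - 1`; and `exotic_trisection_constraints`: an exotic 4-sphere's trisections
  have `3 ≤ g = k₀ + k₁ + k₂` and all `kᵢ ≤ g - 2`, so genus `3` means exactly `(3; 1,1,1)`.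

## References

[MeierZupan2017] [MeierSchirmerZupan2016] [GayKirby2016] [AbramsGayKirby2018] [LeeSmoothManifolds2013]
-/

noncomputable section

open scoped Manifold ContDiff
open Set ContinuousMap

namespace Literature.Barriers.SmoothPoincare4

universe u

/-- Local notation: `𝔼 n` is the model Euclidean space `EuclideanSpace ℝ (Fin n)`. -/
local notation "𝔼 " n:arg => EuclideanSpace ℝ (Fin n)

/-- Local notation: `𝕊 n` is the unit sphere in `EuclideanSpace ℝ (Fin (n + 1))`, the standard
`n`-sphere with its Mathlib manifold structure. -/
local notation "𝕊 " n:arg => (Metric.sphere (0 : EuclideanSpace ℝ (Fin (n + 1))) 1)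

/-! ### The technique class, graded by the trisection genus -/

/-- **Technique class: an exotic 4-sphere with a trisection of genus `≤ g₀`.** There are a closed,
connected, oriented smooth 4-manifold `X` (Hausdorff, second countable, compact, `C^∞` on `ℝ⁴`,
in `Type`, with an `Literature.Topology.FourManifolds.SmoothOrientation`), a Gay–Kirby trisection of `X` of type
`(g; k₀, k₁, k₂)` in the tree's corrected sense (`Literature.IsGKTrisection X g k S`) with `g ≤ g₀`,
a homotopy equivalence `X ≃ₕ S⁴`, and NO diffeomorphism `X ≅ S⁴`. FALSE for `g₀ ≤ 2`
(`lowGenusTrisectionBarrier_of_mz`). [cite: MeierZupan2017, Thm. 1.2 (arXiv Thm. 1.3)] [cite: GayKirby2016, Def. 1] -/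
def ExoticTrisectedSphereOfGenusLE (g₀ : ℕ) : Prop :=
  ∃ (X : Type) (_ : TopologicalSpace X) (_ : T2Space X) (_ : SecondCountableTopology X)
    (_ : ChartedSpace (𝔼 4) X) (_ : IsManifold (𝓡 4) ∞ X) (_ : CompactSpace X)
    (_ : ConnectedSpace X) (_ : Literature.Topology.FourManifolds.SmoothOrientation (𝓡 4) X) (g : ℕ) (k : Fin 3 → ℕ)
    (S : Fin 3 → Set X), Literature.Topology.FourManifolds.IsGKTrisection X g k S ∧ g ≤ g₀ ∧
      Nonempty (X ≃ₕ 𝕊 4) ∧ IsEmpty (X ≃ₘ⟮𝓡 4, 𝓡 4⟯ (𝕊 4))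

/-- The classes grow with the genus bound. [folklore] -/
theorem ExoticTrisectedSphereOfGenusLE.mono {g₀ g₁ : ℕ} (hle : g₀ ≤ g₁)
    (h : ExoticTrisectedSphereOfGenusLE g₀) : ExoticTrisectedSphereOfGenusLE g₁ := by
  obtain ⟨X, _, _, _, _, _, _, _, o, g, k, S, hT, hg, he, hE⟩ := h
  exact ⟨X, inferInstance, inferInstance, inferInstance, inferInstance, inferInstance, inferInstance,
    inferInstance, o, g, k, S, hT, hg.trans hle, he, hE⟩

/-- **Every exotic 4-sphere lies in some class**, GIVEN Gay–Kirby's existence theorem (tree fact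
`Literature.Topology.FourManifolds.exists_isBalancedGKTrisection`, hypothesis `hGK`): a Hausdorff second countable smooth
`X ≃ₕ S⁴` is compact (tree, proved: `Literature.Topology.FourManifolds.compactSpace_of_homotopyEquiv_sphere_four_holds`),
connected (simply connected, transported from `π₁(S⁴) = 1`) and orientable (tree, proved:
`Literature.Topology.FourManifolds.isOrientable_of_homotopyEquiv_sphere_four_holds`), so it has a balanced `(g, k)`-trisection.
Hence the graded family exhausts the refutation problem: an exotic `S⁴` must appear at some genus,
which by the barriers below is `≥ 3`. [cite: GayKirby2016, Thm 4] [cite: LeeSmoothManifolds2013, Thm. 15.43] -/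
theorem exoticTrisectedSphereOfGenusLE_of_exotic (hGK : Literature.Topology.FourManifolds.exists_isBalancedGKTrisection.{0})
    (X : Type) [TopologicalSpace X] [T2Space X] [SecondCountableTopology X]
    [ChartedSpace (𝔼 4) X] [IsManifold (𝓡 4) ∞ X]
    (e : X ≃ₕ 𝕊 4) (hE : IsEmpty (X ≃ₘ⟮𝓡 4, 𝓡 4⟯ (𝕊 4))) :
    ∃ g₀, ExoticTrisectedSphereOfGenusLE g₀ := by
  haveI : CompactSpace X := Literature.Topology.FourManifolds.compactSpace_of_homotopyEquiv_sphere_four_holds X e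
  haveI : SimplyConnectedSpace (𝕊 4) := Literature.Topology.FourManifolds.simplyConnectedSpace_sphere_four_holds
  haveI : SimplyConnectedSpace X := e.simplyConnectedSpace
  haveI : PathConnectedSpace X := inferInstance
  obtain ⟨o⟩ := Literature.Topology.FourManifolds.isOrientable_of_homotopyEquiv_sphere_four_holds X e
  obtain ⟨g, k, S, -, hT⟩ := hGK X o
  exact ⟨g, X, inferInstance, inferInstance, inferInstance, inferInstance, inferInstance,
    inferInstance, inferInstance, o, g, fun _ => k, S, hT, le_rfl, ⟨e⟩, hE⟩

/-! ### The classifications, homotopy-sphere corollaries (named facts over `IsGKTrisection`) -/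

/-- **Meier–Zupan 2017 with Meier–Schirmer–Zupan 2016 and Gay–Kirby (named fact): trisected
homotopy 4-spheres of genus `≤ 2` are `S⁴`.** Let `X` be a closed, connected, oriented smooth
4-manifold with a `(g; k₀, k₁, k₂)`-trisection (`Literature.Topology.FourManifolds.IsGKTrisection`) of genus `g ≤ 2`. If `X` is
homotopy equivalent to `S⁴` then `X ≅ S⁴`: genus `0` is the standard trisection of `S⁴`
(`#⁰(S¹ × S³) = S⁴`); genus `1` gives `ℂP²`, `ℂP²bar`, `S¹ × S³` or (unbalanced) `S⁴`; balanced
genus `2` gives "`S² × S²` or a connected sum of `S¹ × S³`, `ℂP²`, and `ℂP²bar` with two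
summands" (MZ), unbalanced genus `2` falls under MSZ (`k₁ ≥ 1 = g - 1`) — and in each list the
only homotopy 4-sphere is `S⁴`. Conclusion weakened to "`≅ S⁴`" (the full lists need `ℂP²`/sum
vocabulary matched to trisections). Users take `(h : mz_genus_le_two_homotopySphere_gk)`.
[cite: MeierZupan2017, Thm. 1.2 (arXiv Thm. 1.3) and §1] [cite: MeierSchirmerZupan2016, Thm. 1.2 (arXiv numbering)] -/
def mz_genus_le_two_homotopySphere_gk : Prop :=
  ∀ (X : Type u) [TopologicalSpace X] [T2Space X] [SecondCountableTopology X]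
    [ChartedSpace (𝔼 4) X] [IsManifold (𝓡 4) ∞ X] [CompactSpace X] [ConnectedSpace X]
    (_ : Literature.Topology.FourManifolds.SmoothOrientation (𝓡 4) X) (g : ℕ) (k : Fin 3 → ℕ) (S : Fin 3 → Set X),
    Literature.Topology.FourManifolds.IsGKTrisection X g k S → g ≤ 2 → X ≃ₕ 𝕊 4 → Nonempty (X ≃ₘ⟮𝓡 4, 𝓡 4⟯ (𝕊 4))

/-- **Meier–Schirmer–Zupan 2016, Thm. 1.2 (arXiv numbering), homotopy-sphere corollary (named
fact).** Let `X` be a closed, connected, oriented smooth 4-manifold with a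
`(g; k₀, k₁, k₂)`-trisection (`Literature.Topology.FourManifolds.IsGKTrisection`) such that SOME `kᵢ ≥ g - 1` (the sectors may
be relabelled, `IsGKTrisection.comp_perm`). If `X ≃ₕ S⁴` then `X ≅ S⁴` (MSZ: `X` is
`#ᵏ(S¹ × S³)` possibly summed with `ℂP²` or `ℂP²bar`; a homotopy sphere among these is `S⁴`).
Users take `(h : msz_homotopySphere_gk)`. [cite: MeierSchirmerZupan2016, Thm. 1.2 (arXiv numbering)] -/
def msz_homotopySphere_gk : Prop :=
  ∀ (X : Type u) [TopologicalSpace X] [T2Space X] [SecondCountableTopology X]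
    [ChartedSpace (𝔼 4) X] [IsManifold (𝓡 4) ∞ X] [CompactSpace X] [ConnectedSpace X]
    (_ : Literature.Topology.FourManifolds.SmoothOrientation (𝓡 4) X) (g : ℕ) (k : Fin 3 → ℕ) (S : Fin 3 → Set X),
    Literature.Topology.FourManifolds.IsGKTrisection X g k S → (∃ i, g ≤ k i + 1) → X ≃ₕ 𝕊 4 → Nonempty (X ≃ₘ⟮𝓡 4, 𝓡 4⟯ (𝕊 4))

/-! ### The barriers -/

/-- **Barrier (named statement): no exotic 4-sphere has a trisection of genus `≤ 2`**
(`¬ ExoticTrisectedSphereOfGenusLE 2`). PROVED below from the Meier–Zupan / MSZ fact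
(`lowGenusTrisectionBarrier_of_mz`).

BARRIER (D-0021), one line per key:
* technique_class: exhibiting an exotic 4-sphere as a trisected 4-manifold of small genus — a `(g; k₀, k₁, k₂)`-trisection (diagram) with `g ≤ 2`, or with some `kᵢ ≥ g - 1` (`LargeKTrisectionBarrier`) [cite: GayKirby2016, Def. 1]; formally `ExoticTrisectedSphereOfGenusLE 2`; the graded family exhausts all refutations of `SmoothPoincare4` since every closed connected oriented smooth 4-manifold is trisected (`exoticTrisectedSphereOfGenusLE_of_exotic`) [cite: GayKirby2016, Thm 4].
* blocks: refuting `SmoothPoincare4` (`Literature.Topology.FourManifolds.ExistsExoticFourSphere`) at trisection genus `≤ 2` [cite: MeierZupan2017, Thm. 1.2 (arXiv Thm. 1.3)] and at any genus with a sector of `kᵢ ≥ g - 1` one-handles [cite: MeierSchirmerZupan2016, Thm. 1.2 (arXiv numbering)]; for the positive route `GroupTrisection` it marks the solved range: the first undecided type is the balanced `(3; 1, 1, 1)`.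
* because: genus-two trisection diagrams are controlled by the combinatorics of genus-two Heegaard diagrams of `S³` (waves, handle slides), forcing a minimal `(2,0)`-diagram to be one of three standard ones, whence `X ∈ {S² × S², ℂP² # ℂP², ℂP² # ℂP²bar}` in the balanced case and `S¹ × S³`-sums otherwise [cite: MeierZupan2017, Thm. 1.2 (arXiv Thm. 1.3), Thm. 6.5]; `k₁ ≥ g - 1` trisections are handled by Heegaard–Kirby diagrams and the classification of surgeries between connected sums of `S¹ × S²` [cite: MeierSchirmerZupan2016, Thm. 1.2 and §4]; none of the listed manifolds other than `S⁴` is a homotopy sphere; for HOMOTOPY 4-SPHERES the genus-`≤ 2` range needs no Meier–Zupan input at all: `χ(X) = 2 + g − k₀ − k₁ − k₂` [cite: GayKirby2016, Remark 2] [cite: MeierSchirmerZupan2016, Remark 3.12] and `χ = 2` force `g = k₀ + k₁ + k₂`, leaving only the types `(0;0,0,0)`, `(1;1,0,0)`, `(2;2,0,0)`, `(2;1,1,0)` (up to relabelling), all in the MSZ range `kᵢ ≥ g − 1` (`lowGenusTrisectionBarrier_of_msz`, from `msz_homotopySphere_gk` and `Literature.Topology.FourManifolds.gkTrisection_genus_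eq_sum_of_homotopyEquiv_sphere`).
* evasions_known: genus `≥ 3` with all `kᵢ ≤ g - 2`, starting with `(3; 1, 1, 1)`: unclassified; even for the standard `S⁴` "Conjecture 3.11. Every trisection of `S⁴` is isotopic to `S₀` or one of its stabilizations" is open and "likely false" [cite: MeierSchirmerZupan2016, Conjecture 3.11 and §3]; group-trisection reformulation (route `GroupTrisection`) [cite: AbramsGayKirby2018, Thm. 5 and Cor. 6 (p. 1541)].
* scope_caveats: (a) the facts are the homotopy-sphere COROLLARIES of the printed classifications, with conclusion "`≅ S⁴`" (the lists themselves are not rendered) [cite: MeierZupan2017, Thm. 1.2 (arXiv Thm. 1.3)] [cite: MeierSchirmerZupan2016, Thm. 1.2]; (b) they are stated over the tree's corrected predicate `Literature.Topology.FourManifolds.IsGKTrisection` (sectors with corners), whose agreement with Gay–Kirby's Def. 1 is argued in `Trisections.lean` but not a quotable theorem; the older `Literature.Topology.FourManifolds.IsTrisection` versions in `SmallTrisections.lean` are vacuous; (c) theorem numbering follows the held arXiv versions (MZ arXiv Thm. 1.3 = journal Thm. 1.2; MSZ arXiv Thm. 1.2); (d) the Euler-characteristic fact used by `lowGenusTrisectionBarrier_of_msz`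 is itself a named fact (the handle decomposition induced by a trisection and `χ(X) = 2 + g − Σ kᵢ` [cite: GayKirby2016, Remark 2] [cite: MeierSchirmerZupan2016, Remark 3.12 and §4], homotopy invariance of `χ` — none of it in Mathlib).
* status: established (theorems: `lowGenusTrisectionBarrier_of_mz`, `largeKTrisectionBarrier_of_msz`, and `lowGenusTrisectionBarrier_of_msz` — MSZ + Euler characteristic, no Meier–Zupan — from the named facts) [cite: MeierZupan2017, Thm. 1.2 (arXiv Thm. 1.3)] [cite: MeierSchirmerZupan2016, Thm. 1.2]

[cite: MeierZupan2017, Thm. 1.2 (arXiv Thm. 1.3)] [cite: MeierSchirmerZupan2016, Thm. 1.2 (arXiv numbering)] -/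
def LowGenusTrisectionBarrier : Prop :=
  ¬ ExoticTrisectedSphereOfGenusLE 2

/-- **`LowGenusTrisectionBarrier` from Meier–Zupan / MSZ** (hypothesis `hMZ`, D-0014); hence also
`¬ ExoticTrisectedSphereOfGenusLE g₀` for `g₀ ≤ 2` by monotonicity. [cite: MeierZupan2017, Thm. 1.2 (arXiv Thm. 1.3)] -/
theorem lowGenusTrisectionBarrier_of_mz (hMZ : mz_genus_le_two_homotopySphere_gk.{0}) :
    LowGenusTrisectionBarrier := by
  rintro ⟨X, _, _, _, _, _, _, _, o, g, k, S, hT, hg, ⟨e⟩, hE⟩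
  exact hE.false (hMZ X o g k S hT hg e).some

/-- Monotone consequence: no exotic 4-sphere at any genus bound `g₀ ≤ 2`. [cite: MeierZupan2017, Thm. 1.2 (arXiv Thm. 1.3)] -/
theorem not_exoticTrisectedSphereOfGenusLE_of_le_two (hMZ : mz_genus_le_two_homotopySphere_gk.{0})
    {g₀ : ℕ} (h : g₀ ≤ 2) : ¬ ExoticTrisectedSphereOfGenusLE g₀ :=
  fun hx => lowGenusTrisectionBarrier_of_mz hMZ (hx.mono h)

/-- **Barrier (MSZ range, named statement): no exotic 4-sphere has a trisection with some
`kᵢ ≥ g - 1`.** [cite: MeierSchirmerZupan2016, Thm. 1.2 (arXiv numbering)] -/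
def LargeKTrisectionBarrier : Prop :=
  ¬ ∃ (X : Type) (_ : TopologicalSpace X) (_ : T2Space X) (_ : SecondCountableTopology X)
    (_ : ChartedSpace (𝔼 4) X) (_ : IsManifold (𝓡 4) ∞ X) (_ : CompactSpace X)
    (_ : ConnectedSpace X) (_ : Literature.Topology.FourManifolds.SmoothOrientation (𝓡 4) X) (g : ℕ) (k : Fin 3 → ℕ)
    (S : Fin 3 → Set X), Literature.Topology.FourManifolds.IsGKTrisection X g k S ∧ (∃ i, g ≤ k i + 1) ∧
      Nonempty (X ≃ₕ 𝕊 4) ∧ IsEmpty (X ≃ₘ⟮𝓡 4, 𝓡 4⟯ (𝕊 4))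

/-- `LargeKTrisectionBarrier` from MSZ (hypothesis `hMSZ`, D-0014). [cite: MeierSchirmerZupan2016, Thm. 1.2 (arXiv numbering)] -/
theorem largeKTrisectionBarrier_of_msz (hMSZ : msz_homotopySphere_gk.{0}) : LargeKTrisectionBarrier := by
  rintro ⟨X, _, _, _, _, _, _, _, o, g, k, S, hT, hk, ⟨e⟩, hE⟩
  exact hE.false (hMSZ X o g k S hT hk e).some

/-- Consequently, GIVEN the two facts and Gay–Kirby existence, an exotic 4-sphere (if any) has
all its trisections of genus `g ≥ 3` with every `kᵢ ≤ g - 2` — the first possible type being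
`(3; 1, 1, 1)`. Formal form: any trisection of a closed smooth `X ≃ₕ S⁴`, `X ≇ S⁴`, has `3 ≤ g`
and `kᵢ + 2 ≤ g` for all `i`. [cite: MeierZupan2017, Thm. 1.2 (arXiv Thm. 1.3)] [cite: MeierSchirmerZupan2016, Thm. 1.2 (arXiv numbering)] -/
theorem three_le_genus_of_exotic (hMZ : mz_genus_le_two_homotopySphere_gk.{u})
    (hMSZ : msz_homotopySphere_gk.{u})
    (X : Type u) [TopologicalSpace X] [T2Space X] [SecondCountableTopology X]
    [ChartedSpace (𝔼 4) X] [IsManifold (𝓡 4) ∞ X] [CompactSpace X] [ConnectedSpace X]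
    (o : Literature.Topology.FourManifolds.SmoothOrientation (𝓡 4) X) {g : ℕ} {k : Fin 3 → ℕ} {S : Fin 3 → Set X}
    (hT : Literature.Topology.FourManifolds.IsGKTrisection X g k S) (e : X ≃ₕ 𝕊 4) (hE : IsEmpty (X ≃ₘ⟮𝓡 4, 𝓡 4⟯ (𝕊 4))) :
    3 ≤ g ∧ ∀ i, k i + 2 ≤ g := by
  constructor
  · by_contra hlt
    exact hE.false (hMZ X o g k S hT (by omega) e).some
  · intro i
    by_contra hlt
    exact hE.false (hMSZ X o g k S hT ⟨i, by omega⟩ e).some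

/-! ### The genus-`≤ 2` barrier without Meier–Zupan: Euler characteristic and MSZ suffice

For homotopy 4-spheres the classification of `(2; 0,0,0)`-trisections (Meier–Zupan 2017) is not
needed.  By Gay–Kirby's Remark 2 / Meier–Schirmer–Zupan's Remark 3.12 a `(g; k₀, k₁, k₂)`-
trisected closed `X` has `χ(X) = 2 + g − k₀ − k₁ − k₂`, so `X ≃ₕ S⁴` forces `g = k₀ + k₁ + k₂`
(tree fact `Literature.Topology.FourManifolds.gkTrisection_genus_eq_sum_of_homotopyEquiv_sphere`,
over `IsGKTrisection`); for `g ≤ 2` this leaves the types `(0; 0,0,0)`, `(1; 1,0,0)`,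
`(2; 2,0,0)`, `(2; 1,1,0)` up to relabelling, each with some `kᵢ ≥ g − 1` — the range of
Meier–Schirmer–Zupan's Thm. 1.2 (`msz_homotopySphere_gk`).  (MSZ, Remark 3.12: "any trisection
of `S⁴` must satisfy `g = k₁ + k₂ + k₃`"; p. 6: "Theorem 1.2 proves Conjecture 3.11 for the case
of `(g; g − 1, 1, 0)`-trisections".) -/

/-- **The Meier–Zupan-range fact from MSZ and the Euler characteristic.** The genus-`≤ 2`
homotopy-sphere fact `mz_genus_le_two_homotopySphere_gk` follows from the MSZ fact
`msz_homotopySphere_gk` and `gkTrisection_genus_eq_sum_of_homotopyEquiv_sphere`: a genus-`≤ 2`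
trisection of a homotopy 4-sphere has some `kᵢ ≥ g − 1`
(`gkTrisection_genus_eq_sum_of_homotopyEquiv_sphere.exists_le_add_one_of_le_two`).
[cite: MeierSchirmerZupan2016, Thm. 1.2 and Remark 3.12] [cite: GayKirby2016, Remark 2] -/
theorem mz_genus_le_two_homotopySphere_gk_of_msz
    (hχ : Literature.Topology.FourManifolds.gkTrisection_genus_eq_sum_of_homotopyEquiv_sphere.{u})
    (hMSZ : msz_homotopySphere_gk.{u}) : mz_genus_le_two_homotopySphere_gk.{u} := by
  intro X _ _ _ _ _ _ _ o g k S hT hg e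
  exact hMSZ X o g k S hT (hχ.exists_le_add_one_of_le_two X o hT e hg) e

/-- **`LowGenusTrisectionBarrier` from MSZ and the Euler characteristic** (hypotheses `hχ`,
`hMSZ`, D-0014): no exotic 4-sphere has a trisection of genus `≤ 2`, without Meier–Zupan's
genus-two classification. [cite: MeierSchirmerZupan2016, Thm. 1.2 and Remark 3.12] [cite: GayKirby2016, Remark 2] -/
theorem lowGenusTrisectionBarrier_of_msz
    (hχ : Literature.Topology.FourManifolds.gkTrisection_genus_eq_sum_of_homotopyEquiv_sphere.{0})
    (hMSZ : msz_homotopySphere_gk.{0}) : LowGenusTrisectionBarrier :=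
  lowGenusTrisectionBarrier_of_mz (mz_genus_le_two_homotopySphere_gk_of_msz hχ hMSZ)

/-- Monotone consequence (MSZ + Euler characteristic): no exotic 4-sphere at any genus bound
`g₀ ≤ 2`. [cite: MeierSchirmerZupan2016, Thm. 1.2 and Remark 3.12] -/
theorem not_exoticTrisectedSphereOfGenusLE_of_le_two_of_msz
    (hχ : Literature.Topology.FourManifolds.gkTrisection_genus_eq_sum_of_homotopyEquiv_sphere.{0})
    (hMSZ : msz_homotopySphere_gk.{0}) {g₀ : ℕ} (h : g₀ ≤ 2) : ¬ ExoticTrisectedSphereOfGenusLE g₀ :=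
  not_exoticTrisectedSphereOfGenusLE_of_le_two (mz_genus_le_two_homotopySphere_gk_of_msz hχ hMSZ) h

/-- **Constraints on a trisection of an exotic 4-sphere**, GIVEN the MSZ fact and the Euler
characteristic fact: every trisection of a closed smooth `X ≃ₕ S⁴`, `X ≇ S⁴`, has genus
`g ≥ 3`, every `kᵢ ≤ g − 2`, and `g = k₀ + k₁ + k₂`; so the possible types begin `(3; 1,1,1)`,
`(4; 2,1,1)`, `(4; 2,2,0)` (up to relabelling). [cite: MeierSchirmerZupan2016, Thm. 1.2 and Remark 3.12] [cite: GayKirby2016, Remark 2] -/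
theorem exotic_trisection_constraints
    (hχ : Literature.Topology.FourManifolds.gkTrisection_genus_eq_sum_of_homotopyEquiv_sphere.{u})
    (hMSZ : msz_homotopySphere_gk.{u})
    (X : Type u) [TopologicalSpace X] [T2Space X] [SecondCountableTopology X]
    [ChartedSpace (𝔼 4) X] [IsManifold (𝓡 4) ∞ X] [CompactSpace X] [ConnectedSpace X]
    (o : Literature.Topology.FourManifolds.SmoothOrientation (𝓡 4) X) {g : ℕ} {k : Fin 3 → ℕ} {S : Fin 3 → Set X}
    (hT : Literature.Topology.FourManifolds.IsGKTrisection X g k S) (e : X ≃ₕ 𝕊 4) (hE : IsEmpty (X ≃ₘ⟮𝓡 4, 𝓡 4⟯ (𝕊 4))) :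
    3 ≤ g ∧ (∀ i, k i + 2 ≤ g) ∧ g = k 0 + k 1 + k 2 :=
  let h3 := three_le_genus_of_exotic (mz_genus_le_two_homotopySphere_gk_of_msz hχ hMSZ) hMSZ X o hT e hE
  ⟨h3.1, h3.2, hχ X o g k S hT e⟩

/-- In particular (GIVEN the two facts) a genus-`3` trisection of an exotic 4-sphere is of the
balanced type `(3; 1,1,1)` — the first type not decided by the catalogued results.
[cite: MeierSchirmerZupan2016, Thm. 1.2 and Remark 3.12] -/
theorem eq_one_of_exotic_of_genus_three
    (hχ : Literature.Topology.FourManifolds.gkTrisection_genus_eq_sum_of_homotopyEquiv_sphere.{u})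
    (hMSZ : msz_homotopySphere_gk.{u})
    (X : Type u) [TopologicalSpace X] [T2Space X] [SecondCountableTopology X]
    [ChartedSpace (𝔼 4) X] [IsManifold (𝓡 4) ∞ X] [CompactSpace X] [ConnectedSpace X]
    (o : Literature.Topology.FourManifolds.SmoothOrientation (𝓡 4) X) {k : Fin 3 → ℕ} {S : Fin 3 → Set X}
    (hT : Literature.Topology.FourManifolds.IsGKTrisection X 3 k S) (e : X ≃ₕ 𝕊 4) (hE : IsEmpty (X ≃ₘ⟮𝓡 4, 𝓡 4⟯ (𝕊 4)))
    (i : Fin 3) : k i = 1 := by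
  obtain ⟨-, hk, hsum⟩ := exotic_trisection_constraints hχ hMSZ X o hT e hE
  have h0 := hk 0
  have h1 := hk 1
  have h2 := hk 2
  fin_cases i <;> simp only [Fin.zero_eta, Fin.mk_one, Fin.reduceFinMk] <;> omega

end Literature.Barriers.SmoothPoincare4

end
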